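import Summits.Parity.GeneralizedHardyLittlewood.Theorems.LeeYangFibresAbsoluteUpgradeModGammaDefs
import Literature.Analysis.Complex.RectangleContourTools
import HarnessLib

/-!
# Stub `mg_ein` of line `dip-margin-rate-exchange` for crux `LeeYangFibres.AbsoluteUpgrade`
# (stmt-Parity-14116): the complex entire exponential integral `Ein`

We prove the registered stub `mg_ein : MGEin` of the adjoint method for `stub_modGammaDisc`
(vocabulary `LeeYangFibresAbsoluteUpgradeModGammaDefs.lean`): with
`einKernelC x = ∫_0^1 e^{−xu} du` and `einC x = x ∫_0^1 einKernelC (x t) dt`,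

* `einC` is entire (`differentiable_einC`): an interval integral depending holomorphically on a
  parameter is holomorphic (`Literature.Analysis.Complex.differentiableOn_intervalIntegral_of_continuousOn`),
  applied twice (`differentiable_intervalIntegral_comp_mul`);
* on `ℝ` it is the tree's real `Literature.NumberTheory.Sieve.ein` (`einC_ofReal`): the integrand is
  real there (`einKernelC_ofReal`) and `x ∫_0^1 einKernel (x s) ds = ∫_0^x einKernel = Ein x` by the
  substitution `t = x s` (`mul_intervalIntegral_einKernel`, valid for every real `x`);
* `|einC x| ≤ |x| e^{|x|}` (`norm_einC_le`), from `|einKernelC w| ≤ e^{|w|}` (`norm_einKernelC_le`).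

Extras for the neighbouring stubs (`mg_adjointEq`, `mg_adjointAsymp`, `mg_invariantValue`):
`mul_einKernelC : x · einKernelC x = 1 − e^{−x}`, `einKernelC_eq_div`, `einKernelC_zero`, `einC_zero`,
`phiZ_zero : φ_z(0) = 1`, the sup bound `norm_phiZ_le : |φ_z(x)| ≤ exp(|z| |x| e^{|x|})` fed to the
Cauchy–Taylor estimates, and the complex derivative `deriv_einC : deriv einC = einKernelC`,
`hasDerivAt_einC` (identity theorem: both sides are entire and agree on `ℝ` by the tree's
`hasDerivAt_ein`).

References: Greaves 2001 §4.2 (adjoint functions of the sieve delay equations) [Greaves2001];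
Abramowitz–Stegun 5.1.10–5.1.11 (the entire function `Ein`); folklore calculus.
-/

noncomputable section

namespace Summit.Parity.GeneralizedHardyLittlewood.Cruxes.AbsoluteUpgrade.DipMarginRateExchange

open scoped BigOperators Topology
open MeasureTheory Set Filter
open Literature.NumberTheory.Sieve (ein einKernel)

/-! ## Entirety -/

/-- For an entire `f`, the average `x ↦ ∫_0^1 f (x t) dt` is entire (holomorphic dependence of an
interval integral on a parameter,
`Literature.Analysis.Complex.differentiableOn_intervalIntegral_of_continuousOn`). -/
theorem differentiable_intervalIntegral_comp_mul {f : ℂ → ℂ} (hf : Differentiable ℂ f) :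
    Differentiable ℂ (fun x : ℂ => ∫ t in (0 : ℝ)..1, f (x * t)) := by
  have h := Literature.Analysis.Complex.differentiableOn_intervalIntegral_of_continuousOn
    (g := fun (x : ℂ) (t : ℝ) => f (x * t)) (U := univ) isOpen_univ zero_le_one
    (fun t _ => (hf.comp (differentiable_id.mul_const (t : ℂ))).differentiableOn) ?_
  · exact differentiableOn_univ.1 h
  · have hc : Continuous fun q : ℂ × ℝ => f (q.1 * q.2) :=
      hf.continuous.comp (continuous_fst.mul (Complex.continuous_ofReal.comp continuous_snd))
    exact hc.continuousOn

/-- `einKernelC` is entire. -/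
theorem differentiable_einKernelC : Differentiable ℂ einKernelC := by
  have h := differentiable_intervalIntegral_comp_mul (f := fun y : ℂ => Complex.exp (-y))
    (by fun_prop)
  exact h

/-- `einKernelC` is continuous. -/
theorem continuous_einKernelC : Continuous einKernelC :=
  differentiable_einKernelC.continuous

/-- The average `x ↦ ∫_0^1 einKernelC (x t) dt` is entire. -/
theorem differentiable_intervalIntegral_einKernelC :
    Differentiable ℂ (fun x : ℂ => ∫ t in (0 : ℝ)..1, einKernelC (x * t)) :=
  differentiable_intervalIntegral_comp_mul differentiable_einKernelC

/-- **`einC` is entire.** -/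
theorem differentiable_einC : Differentiable ℂ einC := by
  have h : einC = fun x : ℂ => x * ∫ t in (0 : ℝ)..1, einKernelC (x * t) := rfl
  rw [h]
  exact differentiable_id.mul differentiable_intervalIntegral_einKernelC

/-! ## Agreement with the real `Ein` -/

/-- On `ℝ`, `einKernelC` is the tree's real kernel `einKernel`. -/
theorem einKernelC_ofReal (r : ℝ) : einKernelC (r : ℂ) = ((einKernel r : ℝ) : ℂ) := by
  unfold einKernelC
  rw [Literature.NumberTheory.Sieve.einKernel, ← intervalIntegral.integral_ofReal]
  refine intervalIntegral.integral_congr fun u _ => ?_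
  simp only [Complex.ofReal_exp, Complex.ofReal_neg, Complex.ofReal_mul]

/-- The substitution `t = x s` in the real `Ein`: `x ∫_0^1 einKernel (x s) ds = Ein x` (every real `x`,
including `x ≤ 0`). -/
theorem mul_intervalIntegral_einKernel (x : ℝ) :
    x * ∫ t in (0 : ℝ)..1, einKernel (x * t) = ein x := by
  rw [intervalIntegral.mul_integral_comp_mul_left, mul_zero, mul_one]
  rfl

/-- **On `ℝ`, `einC` is the tree's real `Ein`.** -/
theorem einC_ofReal (x : ℝ) : einC (x : ℂ) = ((ein x : ℝ) : ℂ) := by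
  unfold einC
  have h1 : (∫ t in (0 : ℝ)..1, einKernelC ((x : ℂ) * (t : ℂ))) =
      (((∫ t in (0 : ℝ)..1, einKernel (x * t) : ℝ)) : ℂ) := by
    rw [← intervalIntegral.integral_ofReal]
    refine intervalIntegral.integral_congr fun t _ => ?_
    rw [← Complex.ofReal_mul, einKernelC_ofReal]
  rw [h1, ← Complex.ofReal_mul, mul_intervalIntegral_einKernel]

/-! ## Growth -/

/-- `|einKernelC w| ≤ e^{|w|}` (the integrand `e^{−wu}`, `u ∈ [0,1]`, has modulus
`e^{−u Re w} ≤ e^{|w|}`). -/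
theorem norm_einKernelC_le (w : ℂ) : ‖einKernelC w‖ ≤ Real.exp ‖w‖ := by
  unfold einKernelC
  have h := intervalIntegral.norm_integral_le_of_norm_le_const (a := (0 : ℝ)) (b := 1)
    (C := Real.exp ‖w‖) (f := fun u : ℝ => Complex.exp (-(w * u))) fun u hu => ?_
  · simpa using h
  · rw [Set.uIoc_of_le zero_le_one] at hu
    rw [Complex.norm_exp, Real.exp_le_exp]
    simp only [Complex.neg_re, Complex.mul_re, Complex.ofReal_re, Complex.ofReal_im, mul_zero,
      sub_zero]
    calc -(w.re * u) = (-w.re) * u := by ring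
      _ ≤ |w.re| * u := by gcongr; exacts [hu.1.le, neg_le_abs w.re]
      _ ≤ |w.re| * 1 := by gcongr; exact hu.2
      _ = |w.re| := mul_one _
      _ ≤ ‖w‖ := Complex.abs_re_le_norm w

/-- **`|einC x| ≤ |x| e^{|x|}`.** -/
theorem norm_einC_le (x : ℂ) : ‖einC x‖ ≤ ‖x‖ * Real.exp ‖x‖ := by
  unfold einC
  rw [norm_mul]
  refine mul_le_mul_of_nonneg_left ?_ (norm_nonneg x)
  have h := intervalIntegral.norm_integral_le_of_norm_le_const (a := (0 : ℝ)) (b := 1)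
    (C := Real.exp ‖x‖) (f := fun t : ℝ => einKernelC (x * t)) fun t ht => ?_
  · simpa using h
  · rw [Set.uIoc_of_le zero_le_one] at ht
    refine (norm_einKernelC_le _).trans ?_
    rw [Real.exp_le_exp, norm_mul, Complex.norm_real, Real.norm_eq_abs, abs_of_pos ht.1]
    calc ‖x‖ * t ≤ ‖x‖ * 1 := by gcongr; exact ht.2
      _ = ‖x‖ := mul_one _

/-! ## The stub -/

/-- **Stub `mg_ein`** (line `dip-margin-rate-exchange`, adjoint method for `stub_modGammaDisc`): the
complex `Ein` is entire, restricts to the tree's real `Ein` on `ℝ`, and `|einC x| ≤ |x| e^{|x|}`. -/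
theorem mg_ein : MGEin :=
  ⟨differentiable_einC, einC_ofReal, norm_einC_le⟩

/-! ## Extras for the neighbours -/

/-- `x · einKernelC x = 1 − e^{−x}` for every complex `x` (fundamental theorem of calculus in `u`). -/
theorem mul_einKernelC (x : ℂ) : x * einKernelC x = 1 - Complex.exp (-x) := by
  have h0 : ∀ u : ℝ, HasDerivAt (fun u : ℝ => (u : ℂ)) 1 u := fun u => by
    simpa using (hasDerivAt_id u).ofReal_comp
  have hderiv : ∀ u ∈ Set.uIcc (0 : ℝ) 1,
      HasDerivAt (fun u : ℝ => -Complex.exp (-(x * u))) (x * Complex.exp (-(x * u))) u := by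
    intro u _
    have h1 : HasDerivAt (fun u : ℝ => -(x * u)) (-x) u := by
      simpa using ((h0 u).const_mul x).fun_neg
    exact h1.cexp.fun_neg.congr_deriv (by ring)
  have hint : IntervalIntegrable (fun u : ℝ => x * Complex.exp (-(x * u))) volume 0 1 :=
    (Continuous.continuousOn (by fun_prop)).intervalIntegrable
  have h := intervalIntegral.integral_eq_sub_of_hasDerivAt hderiv hint
  rw [intervalIntegral.integral_const_mul] at h
  unfold einKernelC
  rw [h]
  simp only [Complex.ofReal_one, mul_one, Complex.ofReal_zero, mul_zero, neg_zero, Complex.exp_zero]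
  ring

/-- `einKernelC x = (1 − e^{−x})/x` for `x ≠ 0`. -/
theorem einKernelC_eq_div : ∀ {x : ℂ}, x ≠ 0 → einKernelC x = (1 - Complex.exp (-x)) / x := by
  intro x hx
  rw [← mul_einKernelC, mul_div_cancel_left₀ _ hx]

/-- `einKernelC 0 = 1`. -/
theorem einKernelC_zero : einKernelC 0 = 1 := by simp [einKernelC]

/-- `einC 0 = 0`. -/
theorem einC_zero : einC 0 = 0 := by simp [einC]

/-- `φ_z(0) = 1` (so `p_0(z) = 1`). -/
theorem phiZ_zero (z : ℂ) : phiZ z 0 = 1 := by simp [phiZ, einC_zero]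

/-- **The sup bound** `|φ_z(x)| ≤ exp(|z| |x| e^{|x|})` (the `M` of the Cauchy–Taylor estimates
`Literature.Analysis.Complex.norm_sub_taylor_le_of_forall_mem_ball`). -/
theorem norm_phiZ_le : ∀ z x : ℂ, ‖phiZ z x‖ ≤ Real.exp (‖z‖ * (‖x‖ * Real.exp ‖x‖)) := by
  intro z x
  unfold phiZ
  rw [Complex.norm_exp, Real.exp_le_exp]
  calc (-(z * einC x)).re ≤ ‖-(z * einC x)‖ := Complex.re_le_norm _
    _ = ‖z‖ * ‖einC x‖ := by rw [norm_neg, norm_mul]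
    _ ≤ ‖z‖ * (‖x‖ * Real.exp ‖x‖) := by gcongr; exact norm_einC_le x

/-- **`Ein' = einKernelC` on `ℂ`**: `deriv einC = einKernelC` (both are entire and agree on `ℝ`, where
`einC = Ein` has derivative `einKernel` — tree `hasDerivAt_ein`; identity theorem). -/
theorem deriv_einC : deriv einC = einKernelC := by
  have hreal : ∀ r : ℝ, deriv einC r = einKernelC r := by
    intro r
    have h1 : HasDerivAt (fun s : ℝ => einC s) (deriv einC r) r :=
      (differentiable_einC r).hasDerivAt.comp_ofReal
    have h2 : HasDerivAt (fun s : ℝ => einC s) ((einKernel r : ℝ) : ℂ) r :=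
      (Literature.NumberTheory.Sieve.hasDerivAt_ein r).ofReal_comp.congr_of_eventuallyEq
        (Eventually.of_forall fun s => einC_ofReal s)
    rw [h1.unique h2, einKernelC_ofReal]
  have ht : Tendsto (fun t : ℝ => (t : ℂ)) (𝓝[≠] 0) (𝓝[≠] 0) :=
    tendsto_nhdsWithin_of_tendsto_nhds_of_eventually_within _
      ((Complex.continuous_ofReal.tendsto' 0 0 Complex.ofReal_zero).mono_left nhdsWithin_le_nhds)
      (eventually_mem_nhdsWithin.mono fun t ht => by simpa using ht)
  exact AnalyticOnNhd.eq_of_frequently_eq (z₀ := 0)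
    (fun z _ => differentiable_einC.deriv.analyticAt z)
    (fun z _ => differentiable_einKernelC.analyticAt z) (ht.frequently (Frequently.of_forall hreal))

/-- **`HasDerivAt einC (einKernelC x) x`** for every complex `x`. -/
theorem hasDerivAt_einC : ∀ x : ℂ, HasDerivAt einC (einKernelC x) x := by
  intro x
  rw [← deriv_einC]
  exact (differentiable_einC x).hasDerivAt

/-- `φ_z` is entire in `x`. -/
theorem differentiable_phiZ (z : ℂ) : Differentiable ℂ (phiZ z) := by
  have h : phiZ z = fun x => Complex.exp (-(z * einC x)) := rfl
  rw [h]
  exact (differentiable_einC.const_mul z).neg.cexp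

/-- `φ_z' = −z · Ein' · φ_z`: `HasDerivAt (phiZ z) (−(z · einKernelC x) · φ_z(x)) x` (so, with
`x · einKernelC x = 1 − e^{−x}`, the kernel `h = x^z φ_z(x)` satisfies `x h' = z e^{−x} h`). -/
theorem hasDerivAt_phiZ (z x : ℂ) : HasDerivAt (phiZ z) (-(z * einKernelC x) * phiZ z x) x := by
  have h : phiZ z = fun x => Complex.exp (-(z * einC x)) := rfl
  rw [h]
  exact ((hasDerivAt_einC x).const_mul z).fun_neg.cexp.congr_deriv (by ring)

end Summit.Parity.GeneralizedHardyLittlewood.Cruxes.AbsoluteUpgrade.DipMarginRateExchange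

end
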